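import Literature.NumberTheory.Automorphic.U3LocalBruhatDecompositionProofs   -- ★ §1–§2 generic in `n` (`qsInvolution`, cells meeting `U`, `weylLongU`), §4 pattern
import HarnessLib

/-!
# Bruhat decomposition of `U(Φ₂)(K) ≅ U(1,1)` and of `U(Φ₂)(L⁺_v)` at a non-split place: `G = B ⊔ B w₀ N`, unique big-cell coordinates

THEOREMS ONLY (no `def`, no named fact, no instance, no notation, no `sorry`).  Topic `NumberTheory/Automorphic`, namespace
`Literature.NumberTheory.Automorphic.UnitaryGroup`.  Cell `pub/hodgecm-mathlib`, crux H413 (`stmt-HodgeConjecture-24833`), line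
«CMCharIdentityTest» (F0P3b), road (N-H-ii) «§12.1 case (1) for `H_v = U(Φ₂) × U(Φ₁)`», pole H1 «`dim r_B i(χH₂) ≤ 2` for `U(Φ₂)(L⁺_v)`»:
the frame fact the open-cell bound (★ `Representation.finrank_le_of_forall_mem_iff_exists_toFun_one_eq_zero_normalizedInd`) and the
compact support of the cell functions (★ `hasCompactSupport_cellFun_cmBorel (N := 2)`) consume — the `N = 2` TWIN of ★
`U3LocalBruhatDecompositionProofs` §3–§4 (whose §1–§2 are generic in `n` and reused verbatim).

* §1 `n = 2` over any field `K` with involution `σ`, `J = Φ₂ = antidiag(1, 1)`: a permutation of `Fin 2` is `1` or `rev`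
  (`perm_fin_two_eq_one_or_eq_revPerm`), whence **`U(σ, Φ₂)(K) = B_U ⊔ B_U · w₀ · N_U`** (`mem_borelU_or_exists_eq_mul_weylLongU_mul_two`),
  the two pieces DISJOINT (`mul_weylLongU_mul_not_mem_borelU_two`, `weylLongU_not_mem_borelU_two`) and the big-cell coordinates UNIQUE
  (`eq_of_mul_weylLongU_mul_eq_two`) — ★ `revPerm_mul_mul_revPerm_eq_of_mem`, ★ `exists_borel_unipotent_of_mem_bigCell`,
  ★ `eq_of_borel_mul_weylLong_mul_eq`, ★ `disjoint_bruhatCell` at `n = 2`.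
* §2 the CM instance **`u2LocalBruhatDecomposition`**: at a NON-SPLIT finite place `v` of `L⁺` (`L ⊗ L⁺_v` a field, ★
  `LocalRing.isField_of_smul_eq`), for `G = ↥(unitaryGroupOfForm (c ⊗ 1) (cmLocalForm L 2 v))`, `B = borelU`, `N = unipotentU`: there is
  `w₀ ∈ G` with matrix `Φ₂ = cmLocalForm L 2 v`, `w₀ ∉ B`, (i) every `g` lies in `B` or is `b w₀ n`, (ii) `(b, n)` unique — the SAME
  SHAPE as the `N = 3` named fact ★ `U3LocalBruhatDecomposition L` (so the `N = 3` consumers' proofs transpose token for token).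
HONEST LABEL: HC_CM is proved only modulo the printed citations (2 remaining named inputs hLiu418, h413) until rung 0 closes; this file pays
no letter by itself.

## References
* [Casselman1995] W. Casselman, *Introduction to the theory of admissible representations of p-adic reductive groups* (1995), Prop. 1.3.1,
  Prop. 1.3.3 (relative rank one: `G = P ⊔ P w P`).
* [BorelTits1965] A. Borel, J. Tits, *Groupes réductifs*, Publ. Math. IHÉS 27 (1965), §5 Thm. 5.15.
* [Rogawski1990] J. D. Rogawski, *Automorphic Representations of Unitary Groups in Three Variables* (1990), §1.9–§1.10 pp. 8–9
  (`U(1,1) = U(Φ₂)`, `B` upper triangular).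
-/

set_option autoImplicit false

open Matrix

namespace Literature.NumberTheory.Automorphic

namespace UnitaryGroup

/-! ## §1 `n = 2`: `U(σ, Φ₂)(K) = B_U ⊔ B_U · w₀ · N_U` with unique big-cell coordinates -/

section Two

variable {K : Type*} [Field K] (σ : K →+* K)

/-- The permutations of `{0, 1}` (all of them commute with `rev = (0 1)`) are `1` and `rev`. [folklore] -/
private theorem perm_fin_two_eq_one_or_eq_revPerm (τ : Equiv.Perm (Fin 2)) : τ = 1 ∨ τ = Fin.revPerm := by
  revert τ
  decide

variable {J : Matrix (Fin 2) (Fin 2) K} (hJ : J = (StdForm.antidiagonal 2).over K)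
include hJ

/-- **Bruhat decomposition of `U(1,1) = U(σ, Φ₂)(K)`, existence**: every `g ∈ U(σ, Φ₂)(K)` is upper triangular or of the form
`b · w₀ · u` with `b ∈ B_U` and `u ∈ N_U` — `G = B ⊔ B w₀ N` (the `GL₂`-cells of `1` and `rev` both meet `U`).
[cite: Casselman1995, Prop. 1.3.1] [cite: BorelTits1965, §5 Thm. 5.15] [cite: Rogawski1990, §1.10 p. 9] -/
theorem mem_borelU_or_exists_eq_mul_weylLongU_mul_two (g : ↥(unitaryGroupOfForm σ J)) :
    g ∈ borelU σ J ∨ ∃ b ∈ borelU σ J, ∃ u ∈ unipotentU σ J, g = b * weylLongU σ hJ * u := by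
  subst hJ
  have hU : (g : GL (Fin 2) K) ∈ unitaryGroupOfForm σ ((weylLong 2 K : GL (Fin 2) K) : Matrix (Fin 2) (Fin 2) K) := by
    rw [← antidiagonal_over_eq_coe_weylLong]; exact g.2
  obtain ⟨τ, hτ⟩ := exists_mem_bruhatCell (K := K) (g : GL (Fin 2) K)
  rcases perm_fin_two_eq_one_or_eq_revPerm τ with rfl | rfl
  · -- the small cell `B · 1 · U_n = B`
    left
    obtain ⟨b, hb, u, hu, hg⟩ := hτ
    rw [mem_borelU_iff]
    have : (g : GL (Fin 2) K) ∈ standardParabolicGL K (_root_.id : Fin 2 → Fin 2) := by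
      rw [hg, show (permGL (1 : Equiv.Perm (Fin 2)) : GL (Fin 2) K) = 1 from
        Units.ext (by rw [coe_permGL, Matrix.permMatrix_one, Units.val_one]), mul_one]
      exact Subgroup.mul_mem _ hb (upperUnitriangular_le_borel hu)
    exact this
  · -- the big cell
    right
    obtain ⟨b, u, hb, hbU, hu, huU, hg⟩ := exists_borel_unipotent_of_mem_bigCell σ hU hτ
    rw [← antidiagonal_over_eq_coe_weylLong] at hbU huU
    refine ⟨⟨b, hbU⟩, hb, ⟨u, huU⟩, (mem_unipotentU_iff _).2 ((mem_upperUnitriangular_iff _).1 hu), ?_⟩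
    exact Subtype.ext hg

/-- **Bruhat decomposition of `U(1,1)`, disjointness**: `b · w₀ · u ∉ B_U` for `b ∈ B_U`, `u ∈ N_U` (the cells of `1` and `rev` in
`GL₂` are disjoint). [cite: Casselman1995, Prop. 1.3.1] [cite: Rogawski1990, §1.10 p. 9] -/
theorem mul_weylLongU_mul_not_mem_borelU_two {b u : ↥(unitaryGroupOfForm σ J)} (hb : b ∈ borelU σ J) (hu : u ∈ unipotentU σ J) :
    b * weylLongU σ hJ * u ∉ borelU σ J := by
  subst hJ
  intro hmem
  have hmem' : ((b * weylLongU σ rfl * u : ↥(unitaryGroupOfForm σ ((StdForm.antidiagonal 2).over K))) : GL (Fin 2) K) ∈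
      standardParabolicGL K (_root_.id : Fin 2 → Fin 2) := (mem_borelU_iff _).1 hmem
  have h1 : ((b * weylLongU σ rfl * u : ↥(unitaryGroupOfForm σ ((StdForm.antidiagonal 2).over K))) : GL (Fin 2) K) ∈
      bruhatCell (K := K) Fin.revPerm := by
    refine ⟨(b : GL (Fin 2) K), hb, (u : GL (Fin 2) K),
      (mem_upperUnitriangular_iff _).2 ((mem_unipotentU_iff _).1 hu), ?_⟩
    rw [← weylLong_eq_permGL]; rfl
  have h2 : ((b * weylLongU σ rfl * u : ↥(unitaryGroupOfForm σ ((StdForm.antidiagonal 2).over K))) : GL (Fin 2) K) ∈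
      bruhatCell (K := K) 1 := by
    refine ⟨((b * weylLongU σ rfl * u : ↥(unitaryGroupOfForm σ ((StdForm.antidiagonal 2).over K))) : GL (Fin 2) K),
      hmem', 1, Subgroup.one_mem _, ?_⟩
    rw [show (permGL (1 : Equiv.Perm (Fin 2)) : GL (Fin 2) K) = 1 from
      Units.ext (by rw [coe_permGL, Matrix.permMatrix_one, Units.val_one]), mul_one, mul_one]
  have hne : (Fin.revPerm : Equiv.Perm (Fin 2)) ≠ 1 := by decide
  exact Set.disjoint_left.1 (disjoint_bruhatCell (K := K) hne) h1 h2

/-- `w₀ ∉ B_U` in `U(1,1)`. [cite: Rogawski1990, §1.10 p. 9] -/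
theorem weylLongU_not_mem_borelU_two : weylLongU σ hJ ∉ borelU σ J := by
  have h := mul_weylLongU_mul_not_mem_borelU_two σ hJ (Subgroup.one_mem (borelU σ J)) (Subgroup.one_mem (unipotentU σ J))
  rwa [one_mul, mul_one] at h

/-- **Bruhat decomposition of `U(1,1)`, uniqueness of the big-cell coordinates**: `b w₀ u = b′ w₀ u′` with `b, b′ ∈ B_U`,
`u, u′ ∈ N_U` forces `b = b′` and `u = u′`. [cite: BorelTits1965, §5 Thm. 5.15] [cite: Casselman1995, Prop. 1.3.3] -/
theorem eq_of_mul_weylLongU_mul_eq_two {b b' u u' : ↥(unitaryGroupOfForm σ J)}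
    (hb : b ∈ borelU σ J) (hb' : b' ∈ borelU σ J) (hu : u ∈ unipotentU σ J) (hu' : u' ∈ unipotentU σ J)
    (h : b * weylLongU σ hJ * u = b' * weylLongU σ hJ * u') : b = b' ∧ u = u' := by
  subst hJ
  have h' : (b : GL (Fin 2) K) * weylLong 2 K * u = (b' : GL (Fin 2) K) * weylLong 2 K * u' := by
    have := congrArg (fun x : ↥(unitaryGroupOfForm σ ((StdForm.antidiagonal 2).over K)) => (x : GL (Fin 2) K)) h
    simpa only [Subgroup.coe_mul, coe_weylLongU] using this
  obtain ⟨h1, h2⟩ := eq_of_borel_mul_weylLong_mul_eq hb hb'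
    ((mem_upperUnitriangular_iff _).2 ((mem_unipotentU_iff _).1 hu))
    ((mem_upperUnitriangular_iff _).2 ((mem_unipotentU_iff _).1 hu')) h'
  exact ⟨Subtype.ext h1, Subtype.ext h2⟩

end Two

/-! ## §2 The CM instance `U(Φ₂)(L⁺_v)` at a non-split place -/

section CM

open _root_.NumberField _root_.IsDedekindDomain
open scoped MatrixGroups

/-- **Bruhat decomposition of `U(Φ₂)(L⁺_v)` at a NON-SPLIT place** (the `N = 2` twin of ★ `U3LocalBruhatDecomposition_holds`, SAME SHAPE):
there is `w₀ ∈ U(Φ₂)(L⁺_v)` whose matrix is the form matrix `Φ₂ = cmLocalForm L 2 v`, not in `B`, with (i) `G = B ⊔ B w₀ N` and (ii) the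
big-cell coordinates `(b, n)` unique.  At such `v` the semi-local ring `L ⊗ L⁺_v` is a field (★ `LocalRing.isField_of_smul_eq`), and §1
applies to `σ := c ⊗ 1`, `J := cmLocalForm L 2 v = Φ₂` (★ `cmLocalForm_eq_over`).
[cite: Casselman1995, Prop. 1.3.1, Prop. 1.3.3] [cite: BorelTits1965, §5] [cite: Rogawski1990, §1.10 p. 9] -/
theorem u2LocalBruhatDecomposition (L : Type) [Field L] [NumberField L] [IsCMField L]
    (v : HeightOneSpectrum (𝓞 ↥(maximalRealSubfield L))) (hns : ∀ w : PlacesOver L v, IsCMField.complexConj L • w.1 = w.1) :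
    ∃ w₀ : ↥(unitaryGroupOfForm (conjLocal L (IsCMField.complexConj L) v) (cmLocalForm L 2 v)),
      Units.val (w₀ : GL (Fin 2) (LocalRing L v)) = cmLocalForm L 2 v ∧
      w₀ ∉ borelU (conjLocal L (IsCMField.complexConj L) v) (cmLocalForm L 2 v) ∧
      (∀ g : ↥(unitaryGroupOfForm (conjLocal L (IsCMField.complexConj L) v) (cmLocalForm L 2 v)),
        g ∈ borelU (conjLocal L (IsCMField.complexConj L) v) (cmLocalForm L 2 v) ∨
          ∃ b ∈ borelU (conjLocal L (IsCMField.complexConj L) v) (cmLocalForm L 2 v),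
            ∃ n ∈ unipotentU (conjLocal L (IsCMField.complexConj L) v) (cmLocalForm L 2 v), g = b * w₀ * n) ∧
      (∀ b ∈ borelU (conjLocal L (IsCMField.complexConj L) v) (cmLocalForm L 2 v),
        ∀ b' ∈ borelU (conjLocal L (IsCMField.complexConj L) v) (cmLocalForm L 2 v),
        ∀ n ∈ unipotentU (conjLocal L (IsCMField.complexConj L) v) (cmLocalForm L 2 v),
        ∀ n' ∈ unipotentU (conjLocal L (IsCMField.complexConj L) v) (cmLocalForm L 2 v),
          b * w₀ * n = b' * w₀ * n' → b = b' ∧ n = n') := by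
  obtain ⟨w⟩ : Nonempty (PlacesOver L v) := inferInstance
  letI : Field (LocalRing L v) :=
    (LocalRing.isField_of_smul_eq (IsCMField.complexConj L) (IsCMField.complexConj_ne_one L) w (hns w)).toField
  have hJ : cmLocalForm L 2 v = (StdForm.antidiagonal 2).over (LocalRing L v) := cmLocalForm_eq_over L 2 v
  refine ⟨weylLongU (conjLocal L (IsCMField.complexConj L) v) hJ, coe_coe_weylLongU _ hJ,
    weylLongU_not_mem_borelU_two _ hJ, mem_borelU_or_exists_eq_mul_weylLongU_mul_two _ hJ, ?_⟩
  intro b hb b' hb' u hu u' hu' h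
  exact eq_of_mul_weylLongU_mul_eq_two _ hJ hb hb' hu hu' h

end CM

end UnitaryGroup

end Literature.NumberTheory.Automorphic
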